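import Mathlib
import Summits.AnomalousDissipation.AnomalousDissipation.Theses.PointSink
import Literature.Analysis.FluidPDE.StationaryEulerLaminatesHighDim
import Literature.Analysis.FluidPDE.StationaryEulerLaminateWaves
import Literature.Analysis.FluidPDE.StationaryEulerTorusGrid
import Literature.Analysis.FluidPDE.VectorCalculus
import Summits.AnomalousDissipation.AnomalousDissipation.Theorems.PointSinkPointFluxConePressurelessLaminate
import Summits.AnomalousDissipation.AnomalousDissipation.Theorems.PointSinkPointFluxConePressurelessTwoState
import Summits.AnomalousDissipation.AnomalousDissipation.Theorems.PointSinkPointFluxConePressurelessPacket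
import Summits.AnomalousDissipation.AnomalousDissipation.Theorems.PointSinkPointFluxConeBoxStep
import Summits.AnomalousDissipation.AnomalousDissipation.Theorems.PointSinkPointFluxConeBoxIteration
import Summits.AnomalousDissipation.AnomalousDissipation.Theorems.PointSinkPointFluxConeReplicate
import HarnessLib

/-!
# Crux `PointSink.PointFluxCone` (stmt-AnomalousDissipation-19033) — line `Sketch`
  (dilation-periodised wild box, pressureless Tartar-framework engine)

Skeleton of the lead prover.  The crux asks for a discretely self-similar (degrees `(-2/3,-4/3)`)
weak stationary Euler pair `(V, P)` off the origin of `ℝ³` with NON-ZERO log-mean radial energy flux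
over the fundamental shell.  The line:

* **Wild box.** Run the tree's explicit stationary convex-integration scheme
  (`Literature.Analysis.FluidPDE.StationaryEuler*`, Choffrut–Székelyhidi 2014) in the open unit box
  `(0,1)³ ⊂ ℝ³` instead of `T³`, from the strict subsolution `(v₀, 0, 0)` (`3|v₀|² < e`), with two
  additions: (i) the laminates of finite order are PRESSURELESS (every splitting certificate has
  `q = 0`; in `d = 3` the stress gap is absorbed by pairwise exchange splits `fᵢ⊗fᵢ − fⱼ⊗fⱼ`, kernel
  `f_k`, followed by the tree's velocity splits `vLam`), so every wave certificate is trace free and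
  the packet pressure `prC` is a lower-order term, made `≤ δ_k` in sup norm at step `k`; (ii) the
  pressures are carried along, `π = Σ_k prC_k` converges uniformly.  The limit is a bounded,
  compactly supported weak Euler pair `(W, P)`, `P = π − |W|²/3`, with PRESCRIBED Bernoulli function
  `½|W|² + P = e/6 + π` on the box; its log-radial Bernoulli moment about the far point `−c`,
  `∫ (½|W|²+P) ⟪W, x+c⟫/‖x+c‖²`, equals `(1/6)∫⟪v₀,x+c⟫²/‖x+c‖² + O(θ + δ)` for the
  non-constant energy profile `e = E₀ + ⟪v₀, x + c⟫` (the constant part drops out because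
  `(x+c)/‖x+c‖²` is a gradient and `W` is weakly divergence free), hence is non-zero.
* **Replication.** Translate the box to `c + (0,1)³ ⊂ {1 < |y| < 8}` (`c = 3e₀`) and replicate along
  the dilation orbit, `V(y) = Σ_{k∈ℤ} 8^{-2k/3} W(8^{-k}y − c)` (locally one term): exactly DSS, weak
  Euler and weakly divergence free off the origin by scaling covariance and disjointness of the
  shells, and the crux's flux integral over `{1 < |y| < 8}` is the box moment above.

Seven registered stubs, composed by `PointFluxCone_of` (pure modus ponens; each stub from the third
on is an implication from the previous stub's conclusion, restated verbatim):
`stub_pressurelessLaminate` (PL, finite-dimensional), `stub_pressurelessTwoState` (PTS, Lemma 4 with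
the trace bound), `stub_pressurelessPacket : PL → PTS → PPK` (Prop. 6 with pressure),
`stub_boxStep : PPK → STEP` (§2 Step 3 in the box, with pressure), `stub_boxIteration : STEP → ITER`
(the explicit iteration, energies, Cauchy, defects), `stub_wildBox : ITER → WILDBOX` (seed design,
limit, weak Euler with pressure, the moment), `stub_replicate : WILDBOX → PointFluxCone`.
-/

noncomputable section

open scoped InnerProductSpace ContDiff ENNReal Topology
open Set Function MeasureTheory Metric Filter
open Literature.Analysis.FluidPDE Literature.Analysis.FluidPDE.StationaryEuler
open Literature.Analysis.FunctionSpaces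

set_option linter.dupNamespace false

namespace Summit.AnomalousDissipation.AnomalousDissipation.Theorems

/-! ## Stubs 1–5 and 7 — LANDED

* `stub_pressurelessLaminate` — Theorems/PointSinkPointFluxConePressurelessLaminate.lean (p160081)
* `stub_pressurelessTwoState` — Theorems/PointSinkPointFluxConePressurelessTwoState.lean (p160682)
* `stub_pressurelessPacket` — Theorems/PointSinkPointFluxConePressurelessPacket.lean (+Tools) (p161750)
* `stub_boxStep` — Theorems/PointSinkPointFluxConeBoxStep.lean (+Tools) (p161719)
* `stub_boxIteration` — Theorems/PointSinkPointFluxConeBoxIteration.lean (+Tools) (p161989)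
* `stub_replicate` — Theorems/PointSinkPointFluxConeReplicate.lean (+Tools) (p162250)

all in namespace `Summit.AnomalousDissipation.AnomalousDissipation.Theorems`, imported above. -/

/-! ## Stub 6 — the wild box (ITER → WILDBOX) -/

/-- **ITER → WILDBOX (the compactly supported wild weak Euler pair with non-zero log-radial
Bernoulli moment).** Seed: `v₀ = (∂₁ψ, −∂₀ψ, 0)` for a bump `ψ` in the box, `e = E₀ + ⟪v₀, x+c⟫`,
`c = 3e₀`, `w₀ = (v₀, 0)`; run ITER with the test field `(⟪v₀,x+c⟫ (x+c)/‖x+c‖², 0)`; extract an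
a.e.-convergent `L²`-fast subsequence (the tree's `IterData.wlim` argument), get `|v|² = e` a.e. on
the box (defects → 0), `u = v⊗v − (e/3)I` (closedness of `𝒦^{co}`, `mem_K_of_mem_C_of_norm_sq_eq`),
`π_k → π` uniformly; pass the classical identities to the limit by dominated convergence:
`∫⟪v,∇θ⟫ = 0` and `∫ (u + πI):∇Φ = 0` for all tests, i.e. weak Euler with the explicit bounded
pressure `P = π − |v|²/3`; the moment is `(1/6)∫⟪v₀,x+c⟫²/‖x+c‖² + O(θ + δ) ≠ 0`.
[cite: ChoffrutSzekelyhidi2014, §2 Step 3, Lemma 2] -/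
theorem stub_wildBox :
    (∀ (e : Ed (Fin 3) → ℝ) (ebar : ℝ) (w₀ : Ed (Fin 3) → State (Fin 3)) (N : ℕ)
      (p : Fin N → Ed (Fin 3) → State (Fin 3)) (θ δ : ℝ),
      Continuous e → (∀ x, e x ≤ ebar) → ContDiff ℝ ∞ w₀ → (∀ x, x ∉ box (Fin 3) → w₀ x = 0) →
      (∀ x, w₀ x ∈ HighDim.U (e x)) →
      (∀ x, ∑ i, pd (eb i) (fun y => vel (w₀ y) i) x = 0) →
      (∀ x i, ∑ j, pd (eb j) (fun y => str (w₀ y) i j) x = 0) →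
      (∀ a, Continuous (p a)) → 0 < θ → 0 < δ →
      ∃ (w : ℕ → Ed (Fin 3) → State (Fin 3)) (π : ℕ → Ed (Fin 3) → ℝ),
        w 0 = w₀ ∧ (π 0 = fun _ => 0) ∧
        (∀ k, ContDiff ℝ ∞ (w k)) ∧ (∀ k, ContDiff ℝ ∞ (π k)) ∧
        (∀ k x, x ∉ box (Fin 3) → w k x = w₀ x ∧ π k x = 0) ∧
        (∀ k x, w k x ∈ HighDim.U (e x)) ∧
        (∀ k x, |π (k + 1) x - π k x| ≤ δ / 2 ^ (k + 1)) ∧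
        (∀ k x, ∑ i, pd (eb i) (fun y => vel (w k y) i) x = 0) ∧
        (∀ k x i, ∑ j, pd (eb j) (fun y => str (w k y) i j + (if i = j then π k y else 0)) x = 0) ∧
        (∀ η : ℝ, 0 < η → ∃ M : ℕ, ∀ n n', M ≤ n → n ≤ n' → ∫ x, ‖w n' x - w n x‖ ^ 2 < η) ∧
        Tendsto (fun k => ∫ x in box (Fin 3), (e x - ‖vel (w k x)‖ ^ 2)) atTop (𝓝 0) ∧
        (∀ a k, |∫ x, ⟪w k x - w₀ x, p a x⟫_ℝ| ≤ θ)) →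
    (∃ (W : Ed (Fin 3) → Ed (Fin 3)) (P : Ed (Fin 3) → ℝ) (M : ℝ), Measurable W ∧ Measurable P ∧
      (∀ x, ‖W x‖ ≤ M ∧ |P x| ≤ M) ∧
      (∀ x, x ∉ box (Fin 3) → W x = 0 ∧ P x = 0) ∧
      (∀ φ : Ed (Fin 3) → Ed (Fin 3), ContDiff ℝ ∞ φ → HasCompactSupport φ →
        ∫ x, (⟪W x, fderiv ℝ φ x (W x)⟫_ℝ + P x * VectorCalculus.divergence φ x) = 0) ∧
      (∀ θ : Ed (Fin 3) → ℝ, ContDiff ℝ ∞ θ → HasCompactSupport θ →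
        ∫ x, ⟪W x, gradient θ x⟫_ℝ = 0) ∧
      (∫ x, (‖W x‖ ^ 2 / 2 + P x) *
          (⟪W x, x + (3 : ℝ) • eb (0 : Fin 3)⟫_ℝ / ‖x + (3 : ℝ) • eb (0 : Fin 3)‖ ^ 2)) ≠ 0) := by
  sorry

/-! ## Composition -/

/-- **The line closes the crux modulo its seven registered stubs** (pure modus ponens:
`stub_replicate (stub_wildBox (stub_boxIteration (stub_boxStep (stub_pressurelessPacket
stub_pressurelessLaminate stub_pressurelessTwoState))))`). -/
theorem PointFluxCone_of :
    Summit.AnomalousDissipation.AnomalousDissipation.Theses.PointSink.PointFluxCone :=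
  stub_replicate (stub_wildBox (stub_boxIteration (stub_boxStep
    (stub_pressurelessPacket stub_pressurelessLaminate stub_pressurelessTwoState))))

end Summit.AnomalousDissipation.AnomalousDissipation.Theorems

end
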